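import Mathlib.Combinatorics.SimpleGraph.Connectivity.Finite
import Mathlib.Algebra.Ring.Parity
import Literature.Topology.FourManifolds.KhResolutions
import HarnessLib

/-!
# Gauss's parity condition from the merge/split dichotomy

Sibling proof file of `KhResolutions.lean` (no new definition, no named fact). Main results:
`reachable_arcIn_arcOut_of_colouring` (an abstract two-colouring lemma) and

* `odd_overPos_add_underPos_of_dichotomy` — if every edge `σ → σ[i ↦ 1]` of the cube of
  resolutions of the Gauss diagram `G` is a merge or a split (the conclusion of the named fact
  `isMergeAt_or_isSplitAt_of_hasGaussDiagram` of `KhResolutions` for diagrams of knots), then the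
  two passages `overPos i`, `underPos i` of every chord occupy positions of opposite parity
  (**Gauss's parity condition**: along a closed normal plane curve an even number of crossing
  passages separates the two visits of any crossing).

This is the combinatorial input through which Lee's theorem (`finrank_leeHomologyZero_eq_two`,
`LeeRasmussen`) locates the two canonical generators over the *oriented* resolution: an
alternating `𝐚/𝐛`-colouring of the arcs forces Seifert's smoothing at a chord exactly when the
chord joins positions of opposite parity.

Proof. Suppose the chord `i = {o, u}` joins two positions of the same parity. Colour the arcs by
`ℤ/2` so that the colour changes at every marked point except at `o` and at `u`; as the
number of marked points strictly between `o` and `u` is odd, the two arcs at `o` receive one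
colour and the two arcs at `u` the other. At a chord `j ≠ i` both ends are colour changes, so
exactly one of the two reconnections at `j` — untwisted (Seifert's) if the colours entering the
two ends differ, twisted if they agree — preserves the colouring; let the state `σ` choose it at
every `j ≠ i`, with `σ i = 0`. For any state `ρ` with these gluings off `i`, the set `K` of arcs of
the colour of `arcIn o` reachable from `arcIn o` is closed under the gluings at the chords `≠ i`
and misses both arcs at `u`, so by the parity count `even_card_ends_at` it contains `arcOut o`:
the two local strands at chord `i` lie on one circle of `ρ`. Applied to `ρ = σ` and
`ρ = σ[i ↦ 1]`, the edge `σ → σ[i ↦ 1]` is neither a merge nor a split.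

## References

* O. Viro, *Khovanov homology, its definitions and ramifications*, Fund. Math. 184 (2004)
  317–342, §5 (Gauss diagrams; for virtual diagrams an edge of the cube may be a one-to-one
  bifurcation). [cite: Viro2004, §5]
* D. Bar-Natan, *On Khovanov's categorification of the Jones polynomial*, Algebr. Geom. Topol. 2
  (2002) 337–370, §3.1. [cite: BarNatan2002, §3.1]
* E. S. Lee, *An endomorphism of the Khovanov invariant*, Adv. Math. 197 (2005) 554–586, §4.4
  (canonical generators over the oriented resolution). [cite: Lee2005, §4.4]
-/

open Function Set

noncomputable section

namespace Literature.Topology.FourManifolds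

namespace GaussDiagram

variable {G : GaussDiagram}

/-! ## Arc arithmetic -/

/-- The arc leaving the marked point `p` has number `p`. [folklore] -/
theorem arcOut_val (p : Fin (2 * G.n)) : (G.arcOut p).val = p.val := rfl

/-- The arc entering the marked point `p` has number `p - 1`, cyclically: `2n - 1` for `p = 0`.
[folklore] -/
theorem arcIn_val (p : Fin (2 * G.n)) :
    (G.arcIn p).val = if p.val = 0 then 2 * G.n - 1 else p.val - 1 := by
  have hp := p.isLt
  change (p.val + 2 * G.n - 1) % (2 * G.n) = _
  split_ifs with h
  · rw [h, Nat.zero_add, Nat.mod_eq_of_lt (by omega)]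
  · rw [show p.val + 2 * G.n - 1 = (p.val - 1) + 2 * G.n by omega, Nat.add_mod_right,
      Nat.mod_eq_of_lt (by omega)]

/-! ## Colourings changing at every marked point except the ends of one chord -/

/-- **Key step.** Let `o = overPos i`, `u = underPos i`, and let `c` be a two-colouring of the
arcs that changes at every marked point other than `o` and `u`, does not change at `u`, and
gives the arcs entering `o` and `u` different colours (so it does not change at `o` either). Let `ρ` be a state whose
reconnection at every chord `j ≠ i` preserves `c` — i.e. `ρ` takes Seifert's (untwisted)
smoothing at `j` exactly when the colours entering the two ends of `j` differ. Then the two local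
strands `arcIn o`, `arcOut o` at chord `i` lie on one state circle of `ρ`: the arcs of the colour
of `arcIn o` reachable from `arcIn o` form a set closed under the gluings off `i` that misses both
arcs at `u`, hence contains an even number of the four arc-ends at chord `i`
(`even_card_ends_at`), hence contains `arcOut o`. [folklore] -/
theorem reachable_arcIn_arcOut_of_colouring {i : Fin G.n} {c : G.Arc → Bool}
    (hchange : ∀ p : Fin (2 * G.n), p ≠ G.overPos i → p ≠ G.underPos i →
      c (G.arcOut p) = !c (G.arcIn p))
    (hu : c (G.arcOut (G.underPos i)) = c (G.arcIn (G.underPos i)))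
    (hne : c (G.arcIn (G.overPos i)) ≠ c (G.arcIn (G.underPos i))) {ρ : G.State}
    (hρ : ∀ j, j ≠ i → G.isSeifert ρ j =
      (c (G.arcIn (G.overPos j)) != c (G.arcIn (G.underPos j)))) :
    (G.stateGraph ρ).Reachable (G.arcIn (G.overPos i)) (G.arcOut (G.overPos i)) := by
  classical
  set o := G.overPos i with hoi
  set u := G.underPos i with hui
  set K : Set G.Arc := {a | c a = c (G.arcIn o) ∧ (G.stateGraph ρ).Reachable (G.arcIn o) a}
    with hK
  -- `K` is closed under the gluings at the chords `≠ i`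
  have hKcl : ∀ e : Fin (2 * G.n) × Bool, e.1 ≠ o → e.1 ≠ u →
      G.endArc e ∈ K → G.endArc (G.endGlue ρ e) ∈ K := by
    rintro ⟨p, b⟩ hpo hpu ⟨hcol, hreach⟩
    simp only at hpo hpu
    refine ⟨?_, hreach.trans (G.reachable_endArc_endGlue ρ (p, b))⟩
    -- the chord `chordOf p` through `p` is not `i`; its other end `partner p` is off chord `i`
    have hji : G.chordOf p ≠ i := G.chordOf_ne hpo hpu
    have hqo : G.partner p ≠ o := fun h' ↦ hpu (by
      have := congrArg G.partner h'
      simpa [hoi, hui] using this)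
    have hqu : G.partner p ≠ u := fun h' ↦ hpo (by
      have := congrArg G.partner h'
      simpa [hoi, hui] using this)
    have hW : G.isSeifert ρ (G.chordOf p) = (c (G.arcIn p) != c (G.arcIn (G.partner p))) := by
      rw [hρ _ hji]
      rcases G.chordOf_spec p with hp | hp
      · have hq' : G.partner p = G.underPos (G.chordOf p) := by
          conv_lhs => rw [← hp]
          rw [partner_overPos]
        rw [hq', hp]
      · have hq' : G.partner p = G.overPos (G.chordOf p) := by
          conv_lhs => rw [← hp]
          rw [partner_underPos]
        rw [hq', hp]
        generalize c (G.arcIn p) = x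
        generalize c (G.arcIn (G.overPos (G.chordOf p))) = y
        cases x <;> cases y <;> rfl
    have hcp := hchange p hpo hpu
    have hcq := hchange (G.partner p) hqo hqu
    -- in each of the four cases the glued end has the colour of `e`
    have key : c (G.endArc (G.endGlue ρ (p, b))) = c (G.endArc (p, b)) := by
      cases b <;> cases hw : (c (G.arcIn p) != c (G.arcIn (G.partner p)))
      · have hg : G.endGlue ρ (p, false) = (G.partner p, false) := by simp [endGlue, hW, hw]
        rw [hg]
        change c (G.arcIn (G.partner p)) = c (G.arcIn p)
        revert hw
        cases c (G.arcIn p) <;> cases c (G.arcIn (G.partner p)) <;> decide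
      · have hg : G.endGlue ρ (p, false) = (G.partner p, true) := by simp [endGlue, hW, hw]
        rw [hg]
        change c (G.arcOut (G.partner p)) = c (G.arcIn p)
        rw [hcq]
        revert hw
        cases c (G.arcIn p) <;> cases c (G.arcIn (G.partner p)) <;> decide
      · have hg : G.endGlue ρ (p, true) = (G.partner p, true) := by simp [endGlue, hW, hw]
        rw [hg]
        change c (G.arcOut (G.partner p)) = c (G.arcOut p)
        rw [hcp, hcq]
        revert hw
        cases c (G.arcIn p) <;> cases c (G.arcIn (G.partner p)) <;> decide
      · have hg : G.endGlue ρ (p, true) = (G.partner p, false) := by simp [endGlue, hW, hw]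
        rw [hg]
        change c (G.arcIn (G.partner p)) = c (G.arcOut p)
        rw [hcp]
        revert hw
        cases c (G.arcIn p) <;> cases c (G.arcIn (G.partner p)) <;> decide
    rw [key]
    exact hcol
  have hev := G.even_card_ends_at ρ i K hKcl
  -- the end `(o, in)` lies on `K`, the ends at `u` do not (wrong colour)
  have hA : G.endArc (o, false) ∈ K := ⟨rfl, SimpleGraph.Reachable.refl _⟩
  have hC : ∀ b, G.endArc (u, b) ∉ K := by
    rintro (_ | _) ⟨hc, -⟩
    · exact hne hc.symm
    · change c (G.arcOut u) = _ at hc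
      exact hne (hu.symm.trans hc).symm
  -- hence `(o, out)` lies on `K`
  by_contra hB
  have hB' : G.endArc (o, true) ∉ K := fun hk ↦ hB hk.2
  have : (Finset.univ.filter fun e : Fin (2 * G.n) × Bool ↦
      G.endArc e ∈ K ∧ (e.1 = G.overPos i ∨ e.1 = G.underPos i)) = {(o, false)} := by
    ext ⟨p, b⟩
    simp only [Finset.mem_filter, Finset.mem_univ, true_and, Finset.mem_singleton,
      Prod.mk.injEq]
    constructor
    · rintro ⟨hk, hp | hp⟩
      · rw [← hoi] at hp; subst hp
        cases b
        · exact ⟨rfl, rfl⟩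
        · exact absurd hk hB'
      · rw [← hui] at hp; subst hp
        exact absurd hk (hC b)
    · rintro ⟨rfl, rfl⟩
      exact ⟨hA, Or.inl rfl⟩
  rw [this, Finset.card_singleton] at hev
  exact Nat.not_even_one hev

/-- **Gauss's parity condition from the merge/split dichotomy.** If at every `0`-smoothed chord
of every state the flip `0 → 1` is a merge or a split (no one-to-one bifurcation in the cube of
resolutions of `G`; for diagrams of knots this is the named fact
`isMergeAt_or_isSplitAt_of_hasGaussDiagram`), then the over- and the under-passage of every
chord occupy positions of opposite parity, i.e. an even number of marked points lies strictly
between them (Gauss's necessary condition for a chord diagram to be that of a closed normal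
plane curve). Contrapositive: at a chord `i` violating parity, colour the arcs so that the colour
changes exactly at the marked points other than the ends of `i`, let `σ` take at every chord
`j ≠ i` the smoothing whose reconnection preserves the colouring and `σ i = 0`; then `σ` and its
flip at `i` both have the two local strands at `i` on one circle
(`reachable_arcIn_arcOut_of_colouring`), so the edge `σ → σ[i ↦ 1]` is neither a merge nor a
split (Viro (2004), §5: one-to-one bifurcations of virtual diagrams). [folklore] -/
theorem odd_overPos_add_underPos_of_dichotomy
    (hD : ∀ (σ : G.State) (i : Fin G.n), σ i = false → G.IsMergeAt σ i ∨ G.IsSplitAt σ i)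
    (i : Fin G.n) : Odd ((G.overPos i).val + (G.underPos i).val) := by
  by_contra hodd
  have h : ((G.overPos i).val + (G.underPos i).val) % 2 = 0 :=
    Nat.even_iff.1 (Nat.not_odd_iff_even.1 hodd)
  set o := G.overPos i with hoi
  set u := G.underPos i with hui
  have hou : o.val ≠ u.val := fun h' ↦ G.overPos_ne_underPos i i (Fin.ext h')
  have hol := o.isLt
  have hul := u.isLt
  -- the colouring changing at every marked point except `o` and `u`
  let N : ℕ → ℕ := fun q ↦
    q + (if 1 ≤ o.val ∧ o.val ≤ q then 1 else 0) + (if 1 ≤ u.val ∧ u.val ≤ q then 1 else 0)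
  let c : G.Arc → Bool := fun a ↦ decide (N a.val % 2 = 1)
  have hc : ∀ a : G.Arc, c a = decide (N a.val % 2 = 1) := fun a ↦ rfl
  have hchange : ∀ p : Fin (2 * G.n), p ≠ o → p ≠ u → c (G.arcOut p) = !c (G.arcIn p) := by
    intro p hpo hpu
    have hpo' : p.val ≠ o.val := fun h' ↦ hpo (Fin.ext h')
    have hpu' : p.val ≠ u.val := fun h' ↦ hpu (Fin.ext h')
    have hp := p.isLt
    rw [hc, hc, ← decide_not, decide_eq_decide, arcOut_val, arcIn_val]
    simp only [N]
    split_ifs <;> omega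
  have ho : c (G.arcOut o) = c (G.arcIn o) := by
    rw [hc, hc, decide_eq_decide, arcOut_val, arcIn_val]
    simp only [N]
    split_ifs <;> omega
  have hu : c (G.arcOut u) = c (G.arcIn u) := by
    rw [hc, hc, decide_eq_decide, arcOut_val, arcIn_val]
    simp only [N]
    split_ifs <;> omega
  have hne : c (G.arcIn o) ≠ c (G.arcIn u) := by
    rw [← ho, ← hu, hc, hc, Ne, decide_eq_decide, arcOut_val, arcOut_val]
    simp only [N]
    split_ifs <;> omega
  -- the state adapted to the colouring, with the `0`-smoothing at `i`
  let W : Fin G.n → Bool := fun j ↦ (c (G.arcIn (G.overPos j)) != c (G.arcIn (G.underPos j)))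
  let σ : G.State := fun j ↦ if j = i then false else !(W j == (G.sign j == 1))
  have hσi : σ i = false := by simp [σ]
  have hσ : ∀ j, j ≠ i → G.isSeifert σ j = W j := by
    intro j hj
    unfold isSeifert
    rw [show σ j = !(W j == (G.sign j == 1)) by simp [σ, hj]]
    generalize W j = w
    generalize (G.sign j == 1) = s
    cases w <;> cases s <;> rfl
  have h₁ := reachable_arcIn_arcOut_of_colouring hchange hu hne (ρ := σ) hσ
  have h₂ := reachable_arcIn_arcOut_of_colouring hchange hu hne
    (ρ := Function.update σ i true)
    (fun j hj ↦ by rw [G.isSeifert_update_of_ne σ true hj, hσ j hj])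
  rcases hD σ i hσi with ⟨-, hM⟩ | ⟨-, hS⟩
  · exact hM (SimpleGraph.ConnectedComponent.sound h₁)
  · exact hS (SimpleGraph.ConnectedComponent.sound h₂)

/-- Equivalent form: the two passages of a chord have different parities. [folklore] -/
theorem overPos_mod_two_ne_of_dichotomy
    (hD : ∀ (σ : G.State) (i : Fin G.n), σ i = false → G.IsMergeAt σ i ∨ G.IsSplitAt σ i)
    (i : Fin G.n) : (G.overPos i).val % 2 ≠ (G.underPos i).val % 2 := by
  have := Nat.odd_iff.1 (odd_overPos_add_underPos_of_dichotomy hD i)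
  omega

end GaussDiagram

end Literature.Topology.FourManifolds
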